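import Mathlib.Combinatorics.Additive.PluenneckeRuzsa
import Mathlib.Data.Real.Basic
import Mathlib.Tactic
import HarnessLib

/-!
# Route `GreenTaoLevelTwo`, crux `GITwo` (stmt-Parity-21275), line `birth`, stub `stub_cyclicInverse`:
# the vertical fibre of `8Γ' − 8Γ'` over `0` is small (GT08a arXiv Lemma 44, first step)

Tenth helper file toward the XL stub `stub_cyclicInverse` (B. Green, T. Tao, *An inverse theorem for
the Gowers `U³(G)` norm*, arXiv:math/0503014, Thm. 68 = PEMS 51 (2008) Thm. 12.8).  After arXiv
Prop. 27 (file `…CyclicInverseAffine`: the derivative frequencies form a graph `Γ' ⊆ G × Ĝ` with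
`#(kΓ' − lΓ') ≤ K^{k+l} #Γ'`), the linearisation step (arXiv Lemma 44 / Prop. 43) begins: "Let
`A ⊆ Ĝ` be the set of all `ξ` such that `(0, ξ) ∈ 8Γ' − 8Γ'`. Arguing as in the proof of Lemma
(random-slice) we conclude that `|A| ≤ K²`" — because `Γ'` is a graph, `Γ' + ({0} × A)` has
`#Γ' · #A` elements and sits inside `9Γ' − 8Γ'`.  This def-free file lands that step for a graph in
any product of additive commutative groups:

* `card_mul_card_vertFibre_le` — `#Γ' · #{ξ : (0, ξ) ∈ 8Γ' − 8Γ'} ≤ #(9Γ' − 8Γ')` for a graph `Γ'`;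
* `card_vertFibre_le` — hence `#{ξ : (0, ξ) ∈ 8Γ' − 8Γ'} ≤ L` whenever `#(9Γ' − 8Γ') ≤ L · #Γ'`
  (with `L = K¹⁷` from Plünnecke–Ruzsa, `card_nsmul_sub_nsmul_le` of `…CyclicInverseAffine`).

Next (not here): the separation lemma (arXiv Lemma 37) and the torus-cube pigeonhole making
`4Γ'' − 4Γ''` a graph (rest of Lemma 44), then Prop. 43 with the landed Bogolyubov lemma.

References: [GreenTao2008U3Inverse] arXiv:math/0503014, Lemma 44 (and Lemma 29, the model case).
-/

namespace Summit.Parity.GeneralizedHardyLittlewood.GreenTaoLevelTwoGITwoCyclicInverse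

open Finset
open scoped Pointwise

variable {α β : Type*} [AddCommGroup α] [AddCommGroup β] [DecidableEq α] [DecidableEq β]

/-- `9Γ − 8Γ = Γ + (8Γ − 8Γ)` for finsets in an additive commutative group. [folklore] -/
theorem nine_nsmul_sub_eight_nsmul (Γ : Finset (α × β)) :
    9 • Γ - 8 • Γ = Γ + (8 • Γ - 8 • Γ) := by
  rw [show (9 : ℕ) = 8 + 1 from rfl, succ_nsmul', add_sub_assoc]

/-- **The vertical fibre over `0` is small** (counting form): if `Γ ⊆ α × β` is a graph (its first
projection is injective on `Γ`) then `#Γ · #{ξ : (0, ξ) ∈ 8Γ − 8Γ} ≤ #(9Γ − 8Γ)`, via the injection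
`(p, ξ) ↦ p + (0, ξ)`. [cite: GreenTao2008U3Inverse, Lemma 44 (first step; cf. Lemma 29)] -/
theorem card_mul_card_vertFibre_le (Γ : Finset (α × β)) (hgraph : Set.InjOn Prod.fst (Γ : Set (α × β))) :
    #Γ * #(((8 • Γ - 8 • Γ).filter fun p => p.1 = 0).image Prod.snd) ≤ #(9 • Γ - 8 • Γ) := by
  set A := ((8 • Γ - 8 • Γ).filter fun p => p.1 = 0).image Prod.snd with hA
  have hAmem : ∀ ξ ∈ A, ((0 : α), ξ) ∈ 8 • Γ - 8 • Γ := by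
    intro ξ hξ
    rw [hA, mem_image] at hξ
    obtain ⟨p, hp, rfl⟩ := hξ
    rw [mem_filter] at hp
    have : p = (0, p.2) := Prod.ext hp.2 rfl
    rw [← this]; exact hp.1
  rw [← card_product, nine_nsmul_sub_eight_nsmul]
  refine Finset.card_le_card_of_injOn (fun q => q.1 + ((0 : α), q.2)) ?_ ?_
  · intro q hq
    rw [mem_coe, mem_product] at hq
    exact add_mem_add hq.1 (hAmem _ hq.2)
  · intro q hq q' hq' h
    rw [mem_coe, mem_product] at hq hq'
    have h1 : q.1.1 = q'.1.1 := by
      have := congrArg Prod.fst h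
      simpa using this
    have hpq : q.1 = q'.1 := hgraph (mem_coe.mpr hq.1) (mem_coe.mpr hq'.1) h1
    have h2 : q.2 = q'.2 := by
      have := congrArg Prod.snd h
      simp only [Prod.snd_add] at this
      rw [hpq] at this
      exact add_left_cancel this
    exact Prod.ext hpq h2

/-- **The vertical fibre over `0` is small**: for a graph `Γ` with `#(9Γ − 8Γ) ≤ L · #Γ` (e.g.
`L = K¹⁷` by Plünnecke–Ruzsa when `#(Γ − Γ) ≤ K #Γ`), the set `{ξ : (0, ξ) ∈ 8Γ − 8Γ}` has at most
`L` elements. [cite: GreenTao2008U3Inverse, Lemma 44 (first step)] -/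
theorem card_vertFibre_le (Γ : Finset (α × β)) (hne : Γ.Nonempty)
    (hgraph : Set.InjOn Prod.fst (Γ : Set (α × β))) {L : ℝ} (hL : (#(9 • Γ - 8 • Γ) : ℝ) ≤ L * #Γ) :
    (#(((8 • Γ - 8 • Γ).filter fun p => p.1 = 0).image Prod.snd) : ℝ) ≤ L := by
  have hpos : (0 : ℝ) < #Γ := by exact_mod_cast hne.card_pos
  have h := card_mul_card_vertFibre_le Γ hgraph
  have h' : (#Γ : ℝ) * #(((8 • Γ - 8 • Γ).filter fun p => p.1 = 0).image Prod.snd) ≤ L * #Γ :=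
    le_trans (by exact_mod_cast h) hL
  rw [mul_comm] at h'
  exact le_of_mul_le_mul_right h' hpos

omit [AddCommGroup α] [AddCommGroup β] in
/-- The graph of a function is a graph: `Prod.fst` is injective on `{(t, ξ_t) : t ∈ H}`. [folklore] -/
theorem injOn_fst_image_graph (H : Finset α) (ξ : α → β) :
    Set.InjOn Prod.fst ((H.image fun t => (t, ξ t) : Finset (α × β)) : Set (α × β)) := by
  intro p hp q hq h
  rw [mem_coe, mem_image] at hp hq
  obtain ⟨t, -, rfl⟩ := hp
  obtain ⟨s, -, rfl⟩ := hq
  have : t = s := h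
  rw [this]

end Summit.Parity.GeneralizedHardyLittlewood.GreenTaoLevelTwoGITwoCyclicInverse
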